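import Summits.NavierStokesRegularity.NavierStokesRegularity.Theorems.ExtremiserTransienceNearExtremalTransienceExtremiserLiouvilleConstantSpeedSlidePalinstrophyBound
import Summits.NavierStokesRegularity.NavierStokesRegularity.Theorems.ExtremiserTransienceNearExtremalTransienceExtremiserLiouvilleConstantSpeedSlideVariationLipschitz
import HarnessLib

/-!
# Crux `ExtremiserTransience.NearExtremalTransience` (stmt-NavierStokesRegularity-21883), line `extremiser_liouville`,
# stub K1b — THE PALINSTROPHY REMAINDERS ARE SQUARE INTEGRABLE (record §13 update 3, checklist (t3)/(t4))

`--supports stmt-NavierStokesRegularity-21883` (helper).  Author: prover seat `ns-el-k1b` (g9).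

`palinstrophy_slideQuotient_le` (…SlidePalinstrophyBound) bounds `c₁(ψ_h)` along the discrete slide modulo the
integrability of two remainder integrands (`hR`, `hT`).  Here the objects entering them are put in `L²(ℝ³)` using only
`D¹V, D²V ∈ L²` and the square-integrable layer:
* `B = (−V₁, V₀, 0)` is `L ∘ V` with `‖L‖ ≤ 1` (`norm_iteratedFDeriv_crossField_le`); `‖Dⁱ curl V‖ ≤ 4‖Dⁱ⁺¹V‖`;
* the remainder `R(y) := D(curl(gV))(y) − g(y₂)Dω(y) = dx₂ ⊗ (g′ω)(y) + D(g′B)(y)` (`curlRemainder_eq`), so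
  `‖R‖ ≤ |g′|(‖ω‖ + ‖D¹V‖) + |g″|‖V‖`, `‖D¹R‖ ≤ |g′|(‖D¹ω‖ + ‖D²V‖) + |g″|(‖ω‖ + 2‖D¹V‖) + |g‴|‖V‖`, hence
  **`R ∈ L²` and `∂₂R ∈ L²`** (`integrable_sq_norm_curlRemainder`, `memLp_curlRemainder`);
* `Kⱼ = ∂ⱼ(g′V₂)` has `‖DKⱼ‖ ≤ ‖D²(g′V₂)‖ ∈ L²` (`memLp_fderiv_slideCoeffDeriv`).
Consequence (next file): `hR`, `hT` hold for every `h > 0`, and the `h → 0⁺` limits of record §13 R4′ exist.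

WHAT THIS IS NOT: K1b is NOT proved; nothing here proves NS regularity. [folklore]
-/

noncomputable section

open Set Filter Topology MeasureTheory Metric Function InnerProductSpace
open scoped ENNReal NNReal Topology InnerProductSpace RealInnerProductSpace ContDiff
open Literature.Analysis.FluidPDE Literature.Analysis

namespace Summit.NavierStokesRegularity.NavierStokesRegularity.Theorems

-- the problem directory repeats the summit name (`NavierStokesRegularity/NavierStokesRegularity`)
set_option linter.dupNamespace false

namespace ExtremiserLiouville

open DepletionLadder.KStar

variable {V : EuclideanSpace ℝ (Fin 3) → EuclideanSpace ℝ (Fin 3)} {g : ℝ → ℝ}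

/-! ## 1. The cross field `B = (−V₁, V₀, 0)` -/

/-- `‖(−y₁, y₀, 0)‖ ≤ ‖y‖`. [folklore] -/
theorem norm_cross_le (y : EuclideanSpace ℝ (Fin 3)) :
    ‖(-y 1) • EuclideanSpace.single (0 : Fin 3) (1 : ℝ) + (y 0) • EuclideanSpace.single (1 : Fin 3) (1 : ℝ)‖ ≤ ‖y‖ := by
  have h1 : ‖(-y 1) • EuclideanSpace.single (0 : Fin 3) (1 : ℝ) + (y 0) • EuclideanSpace.single (1 : Fin 3) (1 : ℝ)‖ ^ 2 =
      y 1 ^ 2 + y 0 ^ 2 := by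
    rw [EuclideanSpace.norm_sq_eq, Fin.sum_univ_three]
    simp
  have h2 : ‖y‖ ^ 2 = y 0 ^ 2 + y 1 ^ 2 + y 2 ^ 2 := by
    rw [EuclideanSpace.norm_sq_eq, Fin.sum_univ_three]
    simp [sq_abs]
  nlinarith [norm_nonneg ((-y 1) • EuclideanSpace.single (0 : Fin 3) (1 : ℝ) + (y 0) • EuclideanSpace.single (1 : Fin 3) (1 : ℝ)),
    norm_nonneg y, sq_nonneg (y 2)]

/-- The cross field is `L ∘ V` for the linear map `L = −dx₁ ⊗ e₀ + dx₀ ⊗ e₁`, `‖L‖ ≤ 1`. [folklore] -/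
theorem crossField_eq_comp (V : EuclideanSpace ℝ (Fin 3) → EuclideanSpace ℝ (Fin 3)) :
    (fun z : EuclideanSpace ℝ (Fin 3) => (-V z 1) • EuclideanSpace.single (0 : Fin 3) (1 : ℝ) + (V z 0) • EuclideanSpace.single (1 : Fin 3) (1 : ℝ)) =
      ⇑((-(EuclideanSpace.proj (1 : Fin 3) : EuclideanSpace ℝ (Fin 3) →L[ℝ] ℝ)).smulRight (EuclideanSpace.single (0 : Fin 3) (1 : ℝ)) +
          (EuclideanSpace.proj (0 : Fin 3) : EuclideanSpace ℝ (Fin 3) →L[ℝ] ℝ).smulRight (EuclideanSpace.single (1 : Fin 3) (1 : ℝ))) ∘ V := by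
  funext z
  simp [ContinuousLinearMap.smulRight_apply]

/-- `‖−dx₁ ⊗ e₀ + dx₀ ⊗ e₁‖ ≤ 1`. [folklore] -/
theorem norm_crossCLM_le_one :
    ‖(-(EuclideanSpace.proj (1 : Fin 3) : EuclideanSpace ℝ (Fin 3) →L[ℝ] ℝ)).smulRight (EuclideanSpace.single (0 : Fin 3) (1 : ℝ)) +
        (EuclideanSpace.proj (0 : Fin 3) : EuclideanSpace ℝ (Fin 3) →L[ℝ] ℝ).smulRight (EuclideanSpace.single (1 : Fin 3) (1 : ℝ))‖ ≤ 1 := by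
  refine ContinuousLinearMap.opNorm_le_bound _ zero_le_one fun y => ?_
  rw [one_mul]
  have := norm_cross_le y
  simpa [ContinuousLinearMap.smulRight_apply] using this

/-- The cross field of a `Cⁿ` field is `Cⁿ`. [folklore] -/
theorem contDiff_crossField {n : WithTop ℕ∞} (hV : ContDiff ℝ n V) :
    ContDiff ℝ n fun z : EuclideanSpace ℝ (Fin 3) =>
      (-V z 1) • EuclideanSpace.single (0 : Fin 3) (1 : ℝ) + (V z 0) • EuclideanSpace.single (1 : Fin 3) (1 : ℝ) := by
  rw [crossField_eq_comp V]
  exact (ContinuousLinearMap.contDiff _).comp hV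

/-- **`‖Dⁱ B‖ ≤ ‖Dⁱ V‖`** for the cross field `B = (−V₁, V₀, 0)`. [folklore] -/
theorem norm_iteratedFDeriv_crossField_le (hV : ContDiff ℝ ∞ V) (i : ℕ) (y : EuclideanSpace ℝ (Fin 3)) :
    ‖iteratedFDeriv ℝ i (fun z : EuclideanSpace ℝ (Fin 3) =>
        (-V z 1) • EuclideanSpace.single (0 : Fin 3) (1 : ℝ) + (V z 0) • EuclideanSpace.single (1 : Fin 3) (1 : ℝ)) y‖ ≤
      ‖iteratedFDeriv ℝ i V y‖ := by
  rw [crossField_eq_comp V]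
  refine (ContinuousLinearMap.norm_iteratedFDeriv_comp_left _ (hV.contDiffAt) (by exact_mod_cast le_top)).trans ?_
  exact mul_le_of_le_one_left (norm_nonneg _) norm_crossCLM_le_one

/-! ## 2. Curl and its derivatives are controlled by one more derivative of `V` -/

/-- `‖Dⁱ(curl V)‖ ≤ 4‖Dⁱ⁺¹V‖`. [folklore] -/
theorem norm_iteratedFDeriv_curl_le_four (hV : ContDiff ℝ ∞ V) (i : ℕ) (y : EuclideanSpace ℝ (Fin 3)) :
    ‖iteratedFDeriv ℝ i (curl V) y‖ ≤ 4 * ‖iteratedFDeriv ℝ (i + 1) V y‖ := by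
  rw [curl_eq_curlCLM_comp, ← norm_iteratedFDeriv_fderiv]
  have hD : ContDiff ℝ ∞ (fderiv ℝ V) := hV.fderiv_right (m := ∞) (by exact_mod_cast le_rfl)
  refine (ContinuousLinearMap.norm_iteratedFDeriv_comp_left _ hD.contDiffAt (by exact_mod_cast le_top)).trans ?_
  exact mul_le_mul_of_nonneg_right norm_curlCLM_le_four (norm_nonneg _)

/-- `(dx₂ ⊗ v)(w) = w₂ v`. [folklore] -/
theorem smulRightL_proj_two_apply (v w : EuclideanSpace ℝ (Fin 3)) :
    ContinuousLinearMap.smulRightL ℝ (EuclideanSpace ℝ (Fin 3)) (EuclideanSpace ℝ (Fin 3))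
        (EuclideanSpace.proj (2 : Fin 3) : EuclideanSpace ℝ (Fin 3) →L[ℝ] ℝ) v w = w 2 • v := rfl

/-- `dx₂(w) = w₂`. [folklore] -/
theorem proj_two_apply (w : EuclideanSpace ℝ (Fin 3)) :
    (EuclideanSpace.proj (2 : Fin 3) : EuclideanSpace ℝ (Fin 3) →L[ℝ] ℝ) w = w 2 := rfl

/-! ## 3. The remainder `R = D(curl(gV)) − gDω` -/

/-- **`D(curl(gV))(y) − g(y₂)Dω(y) = dx₂ ⊗ (g′(y₂)ω(y)) + D(g′B)(y)`**, `B = (−V₁, V₀, 0)` (from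
`hasFDerivAt_curl_axialWeight_smul`). [folklore] -/
theorem curlRemainder_eq (hV : ContDiff ℝ ∞ V) (hg : ContDiff ℝ ∞ g) :
    (fun y : EuclideanSpace ℝ (Fin 3) =>
        fderiv ℝ (curl (fun z : EuclideanSpace ℝ (Fin 3) => g (z 2) • V z)) y - g (y 2) • fderiv ℝ (curl V) y) =
      fun y => ContinuousLinearMap.smulRightL ℝ (EuclideanSpace ℝ (Fin 3)) (EuclideanSpace ℝ (Fin 3))
          (EuclideanSpace.proj (2 : Fin 3) : EuclideanSpace ℝ (Fin 3) →L[ℝ] ℝ) (deriv g (y 2) • curl V y) +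
        fderiv ℝ (fun z : EuclideanSpace ℝ (Fin 3) => deriv g (z 2) •
          ((-V z 1) • EuclideanSpace.single (0 : Fin 3) (1 : ℝ) + (V z 0) • EuclideanSpace.single (1 : Fin 3) (1 : ℝ))) y := by
  funext y
  have hV2 : ContDiff ℝ 2 V := hV.of_le (WithTop.coe_le_coe.mpr le_top)
  have hg2 : ContDiff ℝ 2 g := hg.of_le (WithTop.coe_le_coe.mpr le_top)
  have hγ : ContDiff ℝ ∞ (deriv g) := (contDiff_infty_iff_deriv.mp hg).2
  have hγd : Differentiable ℝ (deriv g) := hγ.differentiable (by simp)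
  have hBd : Differentiable ℝ fun z : EuclideanSpace ℝ (Fin 3) =>
      (-V z 1) • EuclideanSpace.single (0 : Fin 3) (1 : ℝ) + (V z 0) • EuclideanSpace.single (1 : Fin 3) (1 : ℝ) :=
    (contDiff_crossField hV).differentiable (by simp)
  rw [(hasFDerivAt_curl_axialWeight_smul hV2 hg2 y).fderiv, (hasFDerivAt_axialWeight_smul hBd hγd y).fderiv]
  ext w i
  simp only [sub_apply, add_apply, smul_apply, ContinuousLinearMap.smulRight_apply, smulRightL_proj_two_apply,
    proj_two_apply, PiLp.sub_apply, PiLp.add_apply, PiLp.smul_apply, smul_eq_mul]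
  ring

/-- `‖dx₂ ⊗ ·‖ ≤ 1` as an operator `ℝ³ → L(ℝ³, ℝ³)`. [folklore] -/
theorem norm_smulRightL_proj_le_one :
    ‖ContinuousLinearMap.smulRightL ℝ (EuclideanSpace ℝ (Fin 3)) (EuclideanSpace ℝ (Fin 3))
        (EuclideanSpace.proj (2 : Fin 3) : EuclideanSpace ℝ (Fin 3) →L[ℝ] ℝ)‖ ≤ 1 := by
  refine (ContinuousLinearMap.le_opNorm _ _).trans ?_
  have h1 := ContinuousLinearMap.norm_smulRightL_le (𝕜 := ℝ) (E := EuclideanSpace ℝ (Fin 3)) (Fₗ := EuclideanSpace ℝ (Fin 3))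
  calc ‖ContinuousLinearMap.smulRightL ℝ (EuclideanSpace ℝ (Fin 3)) (EuclideanSpace ℝ (Fin 3))‖ *
        ‖(EuclideanSpace.proj (2 : Fin 3) : EuclideanSpace ℝ (Fin 3) →L[ℝ] ℝ)‖ ≤ 1 * 1 :=
        mul_le_mul h1 norm_proj_two_le (norm_nonneg _) zero_le_one
    _ = 1 := one_mul _

/-- The remainder `R = D(curl(gV)) − gDω` is `C^∞`. [folklore] -/
theorem contDiff_curlRemainder (hV : ContDiff ℝ ∞ V) (hg : ContDiff ℝ ∞ g) :
    ContDiff ℝ ∞ fun y : EuclideanSpace ℝ (Fin 3) =>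
      fderiv ℝ (curl (fun z : EuclideanSpace ℝ (Fin 3) => g (z 2) • V z)) y - g (y 2) • fderiv ℝ (curl V) y := by
  have hproj : ContDiff ℝ ∞ fun y : EuclideanSpace ℝ (Fin 3) => y 2 :=
    (EuclideanSpace.proj (2 : Fin 3) : EuclideanSpace ℝ (Fin 3) →L[ℝ] ℝ).contDiff
  have hΨ : ContDiff ℝ ∞ fun z : EuclideanSpace ℝ (Fin 3) => g (z 2) • V z := (hg.comp hproj).smul hV
  have hωΨ : ContDiff ℝ ∞ (curl fun z : EuclideanSpace ℝ (Fin 3) => g (z 2) • V z) :=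
    contDiff_curl (n := ⊤) (hΨ.of_le (by exact_mod_cast le_top))
  have hω : ContDiff ℝ ∞ (curl V) := contDiff_curl (n := ⊤) (hV.of_le (by exact_mod_cast le_top))
  exact (hωΨ.fderiv_right (m := ∞) (by exact_mod_cast le_rfl)).sub
    ((hg.comp hproj).smul (hω.fderiv_right (m := ∞) (by exact_mod_cast le_rfl)))

/-- **`‖R(y)‖ ≤ |g′(y₂)|(‖ω(y)‖ + ‖D¹V(y)‖) + |g″(y₂)|‖V(y)‖`**. [folklore] -/
theorem norm_curlRemainder_le (hV : ContDiff ℝ ∞ V) (hg : ContDiff ℝ ∞ g) (y : EuclideanSpace ℝ (Fin 3)) :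
    ‖fderiv ℝ (curl (fun z : EuclideanSpace ℝ (Fin 3) => g (z 2) • V z)) y - g (y 2) • fderiv ℝ (curl V) y‖ ≤
      |deriv g (y 2)| * (‖curl V y‖ + ‖iteratedFDeriv ℝ 1 V y‖) + |deriv (deriv g) (y 2)| * ‖V y‖ := by
  have hγ : ContDiff ℝ ∞ (deriv g) := (contDiff_infty_iff_deriv.mp hg).2
  have hB : ContDiff ℝ ∞ fun z : EuclideanSpace ℝ (Fin 3) =>
      (-V z 1) • EuclideanSpace.single (0 : Fin 3) (1 : ℝ) + (V z 0) • EuclideanSpace.single (1 : Fin 3) (1 : ℝ) :=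
    contDiff_crossField hV
  have e := congrFun (curlRemainder_eq hV hg) y
  simp only at e
  rw [e]
  refine (norm_add_le _ _).trans ?_
  have h1 : ‖ContinuousLinearMap.smulRightL ℝ (EuclideanSpace ℝ (Fin 3)) (EuclideanSpace ℝ (Fin 3))
      (EuclideanSpace.proj (2 : Fin 3) : EuclideanSpace ℝ (Fin 3) →L[ℝ] ℝ) (deriv g (y 2) • curl V y)‖ ≤
      |deriv g (y 2)| * ‖curl V y‖ := by
    refine (ContinuousLinearMap.le_opNorm _ _).trans ?_
    rw [norm_smul, Real.norm_eq_abs]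
    exact mul_le_of_le_one_left (by positivity) norm_smulRightL_proj_le_one
  have h2 : ‖fderiv ℝ (fun z : EuclideanSpace ℝ (Fin 3) => deriv g (z 2) •
      ((-V z 1) • EuclideanSpace.single (0 : Fin 3) (1 : ℝ) + (V z 0) • EuclideanSpace.single (1 : Fin 3) (1 : ℝ))) y‖ ≤
      |deriv g (y 2)| * ‖iteratedFDeriv ℝ 1 V y‖ + |deriv (deriv g) (y 2)| * ‖V y‖ := by
    rw [← norm_iteratedFDeriv_zero (𝕜 := ℝ) (f := fderiv ℝ (fun z : EuclideanSpace ℝ (Fin 3) => deriv g (z 2) •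
      ((-V z 1) • EuclideanSpace.single (0 : Fin 3) (1 : ℝ) + (V z 0) • EuclideanSpace.single (1 : Fin 3) (1 : ℝ)))),
      norm_iteratedFDeriv_fderiv]
    refine (norm_iteratedFDeriv_axialWeight_smul_le hB hγ y).1.trans (add_le_add ?_ ?_)
    · exact mul_le_mul_of_nonneg_left (norm_iteratedFDeriv_crossField_le hV 1 y) (abs_nonneg _)
    · refine mul_le_mul_of_nonneg_left ?_ (abs_nonneg _)
      have := norm_iteratedFDeriv_crossField_le hV 0 y
      rwa [norm_iteratedFDeriv_zero, norm_iteratedFDeriv_zero] at this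
  calc _ ≤ |deriv g (y 2)| * ‖curl V y‖ + (|deriv g (y 2)| * ‖iteratedFDeriv ℝ 1 V y‖ + |deriv (deriv g) (y 2)| * ‖V y‖) :=
        add_le_add h1 h2
    _ = _ := by ring

/-- **`‖D¹R(y)‖ ≤ |g′|(‖D¹ω‖ + ‖D²V‖) + |g″|(‖ω‖ + 2‖D¹V‖) + |g‴|‖V‖`** (all at `y`). [folklore] -/
theorem norm_iteratedFDeriv_one_curlRemainder_le (hV : ContDiff ℝ ∞ V) (hg : ContDiff ℝ ∞ g) (y : EuclideanSpace ℝ (Fin 3)) :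
    ‖iteratedFDeriv ℝ 1 (fun y : EuclideanSpace ℝ (Fin 3) =>
        fderiv ℝ (curl (fun z : EuclideanSpace ℝ (Fin 3) => g (z 2) • V z)) y - g (y 2) • fderiv ℝ (curl V) y) y‖ ≤
      |deriv g (y 2)| * (‖iteratedFDeriv ℝ 1 (curl V) y‖ + ‖iteratedFDeriv ℝ 2 V y‖) +
        |deriv (deriv g) (y 2)| * (‖curl V y‖ + 2 * ‖iteratedFDeriv ℝ 1 V y‖) +
        |deriv (deriv (deriv g)) (y 2)| * ‖V y‖ := by
  have hproj : ContDiff ℝ ∞ fun y : EuclideanSpace ℝ (Fin 3) => y 2 :=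
    (EuclideanSpace.proj (2 : Fin 3) : EuclideanSpace ℝ (Fin 3) →L[ℝ] ℝ).contDiff
  have hγ : ContDiff ℝ ∞ (deriv g) := (contDiff_infty_iff_deriv.mp hg).2
  have hω : ContDiff ℝ ∞ (curl V) := contDiff_curl (n := ⊤) (hV.of_le (by exact_mod_cast le_top))
  have hB : ContDiff ℝ ∞ fun z : EuclideanSpace ℝ (Fin 3) =>
      (-V z 1) • EuclideanSpace.single (0 : Fin 3) (1 : ℝ) + (V z 0) • EuclideanSpace.single (1 : Fin 3) (1 : ℝ) :=
    contDiff_crossField hV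
  have hP : ContDiff ℝ ∞ fun y : EuclideanSpace ℝ (Fin 3) => deriv g (y 2) • curl V y := (hγ.comp hproj).smul hω
  have hγB : ContDiff ℝ ∞ fun z : EuclideanSpace ℝ (Fin 3) => deriv g (z 2) •
      ((-V z 1) • EuclideanSpace.single (0 : Fin 3) (1 : ℝ) + (V z 0) • EuclideanSpace.single (1 : Fin 3) (1 : ℝ)) :=
    (hγ.comp hproj).smul hB
  rw [curlRemainder_eq hV hg]
  set L := ContinuousLinearMap.smulRightL ℝ (EuclideanSpace ℝ (Fin 3)) (EuclideanSpace ℝ (Fin 3))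
      (EuclideanSpace.proj (2 : Fin 3) : EuclideanSpace ℝ (Fin 3) →L[ℝ] ℝ) with hL
  have hA : ContDiff ℝ ∞ fun y : EuclideanSpace ℝ (Fin 3) => L (deriv g (y 2) • curl V y) := L.contDiff.comp hP
  have hD : ContDiff ℝ ∞ fun y : EuclideanSpace ℝ (Fin 3) => fderiv ℝ (fun z : EuclideanSpace ℝ (Fin 3) => deriv g (z 2) •
      ((-V z 1) • EuclideanSpace.single (0 : Fin 3) (1 : ℝ) + (V z 0) • EuclideanSpace.single (1 : Fin 3) (1 : ℝ))) y :=
    hγB.fderiv_right (m := ∞) (by exact_mod_cast le_rfl)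
  rw [fun_iteratedFDeriv_add_apply (i := 1) (hA.of_le (by exact_mod_cast le_top)).contDiffAt
    (hD.of_le (by exact_mod_cast le_top)).contDiffAt]
  refine (norm_add_le _ _).trans ?_
  -- the `dx₂ ⊗ (g′ω)` part
  have h1 : ‖iteratedFDeriv ℝ 1 (fun y : EuclideanSpace ℝ (Fin 3) => L (deriv g (y 2) • curl V y)) y‖ ≤
      |deriv g (y 2)| * ‖iteratedFDeriv ℝ 1 (curl V) y‖ + |deriv (deriv g) (y 2)| * ‖curl V y‖ := by
    have hc : (fun y : EuclideanSpace ℝ (Fin 3) => L (deriv g (y 2) • curl V y)) =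
        ⇑L ∘ fun y : EuclideanSpace ℝ (Fin 3) => deriv g (y 2) • curl V y := rfl
    rw [hc]
    refine (ContinuousLinearMap.norm_iteratedFDeriv_comp_left L hP.contDiffAt (by exact_mod_cast le_top)).trans ?_
    refine (mul_le_of_le_one_left (norm_nonneg _) norm_smulRightL_proj_le_one).trans ?_
    exact (norm_iteratedFDeriv_axialWeight_smul_le hω hγ y).1
  -- the `D(g′B)` part
  have h2 : ‖iteratedFDeriv ℝ 1 (fun y => fderiv ℝ (fun z : EuclideanSpace ℝ (Fin 3) => deriv g (z 2) •
      ((-V z 1) • EuclideanSpace.single (0 : Fin 3) (1 : ℝ) + (V z 0) • EuclideanSpace.single (1 : Fin 3) (1 : ℝ))) y) y‖ ≤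
      |deriv g (y 2)| * ‖iteratedFDeriv ℝ 2 V y‖ + 2 * |deriv (deriv g) (y 2)| * ‖iteratedFDeriv ℝ 1 V y‖ +
        |deriv (deriv (deriv g)) (y 2)| * ‖V y‖ := by
    rw [show (fun y => fderiv ℝ (fun z : EuclideanSpace ℝ (Fin 3) => deriv g (z 2) •
      ((-V z 1) • EuclideanSpace.single (0 : Fin 3) (1 : ℝ) + (V z 0) • EuclideanSpace.single (1 : Fin 3) (1 : ℝ))) y) =
      fderiv ℝ (fun z : EuclideanSpace ℝ (Fin 3) => deriv g (z 2) •
      ((-V z 1) • EuclideanSpace.single (0 : Fin 3) (1 : ℝ) + (V z 0) • EuclideanSpace.single (1 : Fin 3) (1 : ℝ))) from rfl,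
      norm_iteratedFDeriv_fderiv]
    refine (norm_iteratedFDeriv_axialWeight_smul_le hB hγ y).2.trans (add_le_add (add_le_add ?_ ?_) ?_)
    · exact mul_le_mul_of_nonneg_left (norm_iteratedFDeriv_crossField_le hV 2 y) (abs_nonneg _)
    · exact mul_le_mul_of_nonneg_left (norm_iteratedFDeriv_crossField_le hV 1 y) (by positivity)
    · refine mul_le_mul_of_nonneg_left ?_ (abs_nonneg _)
      have := norm_iteratedFDeriv_crossField_le hV 0 y
      rwa [norm_iteratedFDeriv_zero, norm_iteratedFDeriv_zero] at this
  calc _ ≤ (|deriv g (y 2)| * ‖iteratedFDeriv ℝ 1 (curl V) y‖ + |deriv (deriv g) (y 2)| * ‖curl V y‖) +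
        (|deriv g (y 2)| * ‖iteratedFDeriv ℝ 2 V y‖ + 2 * |deriv (deriv g) (y 2)| * ‖iteratedFDeriv ℝ 1 V y‖ +
          |deriv (deriv (deriv g)) (y 2)| * ‖V y‖) := add_le_add h1 h2
    _ = _ := by ring

/-! ## 4. `R ∈ L²` and `D¹R ∈ L²` on a square-integrable layer -/

/-- `(p + q)²`-type bookkeeping: `a ≤ p + q`, `0 ≤ a` give `a² ≤ 2p² + 2q²`. [folklore] -/
theorem sq_le_two_sq_add_two_sq {a p q : ℝ} (ha : 0 ≤ a) (h : a ≤ p + q) : a ^ 2 ≤ 2 * p ^ 2 + 2 * q ^ 2 := by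
  nlinarith [sq_nonneg (p - q), mul_le_mul h h ha (ha.trans h)]

/-- `a ≤ p + q + r`, `0 ≤ a` give `a² ≤ 3p² + 3q² + 3r²`. [folklore] -/
theorem sq_le_three_sq {a p q r : ℝ} (ha : 0 ≤ a) (h : a ≤ p + q + r) : a ^ 2 ≤ 3 * p ^ 2 + 3 * q ^ 2 + 3 * r ^ 2 := by
  nlinarith [sq_nonneg (p - q), sq_nonneg (q - r), sq_nonneg (p - r), mul_le_mul h h ha (ha.trans h)]

/-- **`R ∈ L²` and `D¹R ∈ L²`** (`R = D(curl(gV)) − gDω`) when `g′, g″, g‴` are bounded, `g″ = g‴ = 0` off `[−T,T]`,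
`D¹V, D²V ∈ L²` and the slab `{|x₂| ≤ T}` is square integrable for `V`. [folklore] -/
theorem integrable_sq_norm_curlRemainder (hV : ContDiff ℝ ∞ V) (hg : ContDiff ℝ ∞ g) {T K1 K2 K3 : ℝ}
    (hK1 : ∀ s, |deriv g s| ≤ K1) (hK2 : ∀ s, |deriv (deriv g) s| ≤ K2) (hK3 : ∀ s, |deriv (deriv (deriv g)) s| ≤ K3)
    (hT2 : ∀ s, T < |s| → deriv (deriv g) s = 0) (hT3 : ∀ s, T < |s| → deriv (deriv (deriv g)) s = 0)
    (h1 : ∫⁻ x, ‖iteratedFDeriv ℝ 1 V x‖ₑ ^ 2 < ⊤) (h2 : ∫⁻ x, ‖iteratedFDeriv ℝ 2 V x‖ₑ ^ 2 < ⊤)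
    (hslab : Integrable (fun x => {x : EuclideanSpace ℝ (Fin 3) | |x 2| ≤ T}.indicator (fun x => ‖V x‖ ^ 2) x) volume) :
    Integrable (fun y => ‖fderiv ℝ (curl (fun z : EuclideanSpace ℝ (Fin 3) => g (z 2) • V z)) y - g (y 2) • fderiv ℝ (curl V) y‖ ^ 2)
        (volume : Measure (EuclideanSpace ℝ (Fin 3))) ∧
      Integrable (fun y => ‖iteratedFDeriv ℝ 1 (fun y : EuclideanSpace ℝ (Fin 3) =>
        fderiv ℝ (curl (fun z : EuclideanSpace ℝ (Fin 3) => g (z 2) • V z)) y - g (y 2) • fderiv ℝ (curl V) y) y‖ ^ 2)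
        (volume : Measure (EuclideanSpace ℝ (Fin 3))) := by
  set S : Set (EuclideanSpace ℝ (Fin 3)) := {x | |x 2| ≤ T} with hS
  have hR := contDiff_curlRemainder hV hg
  have cR := hR.continuous
  have cDR : Continuous (iteratedFDeriv ℝ 1 (fun y : EuclideanSpace ℝ (Fin 3) =>
      fderiv ℝ (curl (fun z : EuclideanSpace ℝ (Fin 3) => g (z 2) • V z)) y - g (y 2) • fderiv ℝ (curl V) y)) :=
    hR.continuous_iteratedFDeriv (WithTop.coe_le_coe.mpr le_top)
  have hD1 : Integrable (fun x => ‖iteratedFDeriv ℝ 1 V x‖ ^ 2) (volume : Measure (EuclideanSpace ℝ (Fin 3))) :=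
    integrable_sq_norm_of_lintegral (hV.continuous_iteratedFDeriv (WithTop.coe_le_coe.mpr le_top)) h1
  have hD2 : Integrable (fun x => ‖iteratedFDeriv ℝ 2 V x‖ ^ 2) (volume : Measure (EuclideanSpace ℝ (Fin 3))) :=
    integrable_sq_norm_of_lintegral (hV.continuous_iteratedFDeriv (WithTop.coe_le_coe.mpr le_top)) h2
  have hK1nn : 0 ≤ K1 := (abs_nonneg _).trans (hK1 0)
  have hK2nn : 0 ≤ K2 := (abs_nonneg _).trans (hK2 0)
  have hω0 : ∀ y, ‖curl V y‖ ≤ 4 * ‖iteratedFDeriv ℝ 1 V y‖ := fun y => by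
    have := norm_iteratedFDeriv_curl_le_four hV 0 y; rwa [norm_iteratedFDeriv_zero] at this
  have hω1 : ∀ y, ‖iteratedFDeriv ℝ 1 (curl V) y‖ ≤ 4 * ‖iteratedFDeriv ℝ 2 V y‖ := fun y => norm_iteratedFDeriv_curl_le_four hV 1 y
  have hind2 := fun y => sq_mul_sq_le_indicator (V := V) (w := deriv (deriv g)) hK2 hT2 y
  have hind3 := fun y => sq_mul_sq_le_indicator (V := V) (w := deriv (deriv (deriv g))) hK3 hT3 y
  constructor
  · refine (((hD1.const_mul (2 * (5 * K1) ^ 2)).add ((hslab.const_mul (K2 ^ 2)).const_mul 2))).mono'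
      (cR.norm.pow 2).aestronglyMeasurable (Eventually.of_forall fun y => ?_)
    rw [Real.norm_eq_abs, abs_of_nonneg (sq_nonneg _)]
    have hle := norm_curlRemainder_le hV hg y
    have hb : ‖fderiv ℝ (curl (fun z : EuclideanSpace ℝ (Fin 3) => g (z 2) • V z)) y - g (y 2) • fderiv ℝ (curl V) y‖ ≤
        5 * K1 * ‖iteratedFDeriv ℝ 1 V y‖ + |deriv (deriv g) (y 2)| * ‖V y‖ := by
      refine hle.trans (add_le_add ?_ le_rfl)
      calc |deriv g (y 2)| * (‖curl V y‖ + ‖iteratedFDeriv ℝ 1 V y‖)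
          ≤ K1 * (4 * ‖iteratedFDeriv ℝ 1 V y‖ + ‖iteratedFDeriv ℝ 1 V y‖) :=
            mul_le_mul (hK1 _) (add_le_add (hω0 y) le_rfl) (by positivity) hK1nn
        _ = 5 * K1 * ‖iteratedFDeriv ℝ 1 V y‖ := by ring
    have hsq := sq_le_two_sq_add_two_sq (norm_nonneg _) hb
    simp only [Pi.add_apply]
    calc _ ≤ 2 * (5 * K1 * ‖iteratedFDeriv ℝ 1 V y‖) ^ 2 + 2 * (|deriv (deriv g) (y 2)| * ‖V y‖) ^ 2 := hsq
      _ = 2 * (5 * K1) ^ 2 * ‖iteratedFDeriv ℝ 1 V y‖ ^ 2 + 2 * (deriv (deriv g) (y 2) ^ 2 * ‖V y‖ ^ 2) := by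
          simp only [mul_pow, sq_abs]; ring
      _ ≤ 2 * (5 * K1) ^ 2 * ‖iteratedFDeriv ℝ 1 V y‖ ^ 2 + 2 * (K2 ^ 2 * S.indicator (fun x => ‖V x‖ ^ 2) y) :=
          add_le_add le_rfl (mul_le_mul_of_nonneg_left (hind2 y) zero_le_two)
  · refine ((((hD2.const_mul (3 * (5 * K1) ^ 2)).add (hD1.const_mul (3 * (6 * K2) ^ 2))).add
        ((hslab.const_mul (K3 ^ 2)).const_mul 3))).mono' (cDR.norm.pow 2).aestronglyMeasurable
      (Eventually.of_forall fun y => ?_)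
    rw [Real.norm_eq_abs, abs_of_nonneg (sq_nonneg _)]
    have hle := norm_iteratedFDeriv_one_curlRemainder_le hV hg y
    have hb : ‖iteratedFDeriv ℝ 1 (fun y : EuclideanSpace ℝ (Fin 3) =>
        fderiv ℝ (curl (fun z : EuclideanSpace ℝ (Fin 3) => g (z 2) • V z)) y - g (y 2) • fderiv ℝ (curl V) y) y‖ ≤
        5 * K1 * ‖iteratedFDeriv ℝ 2 V y‖ + 6 * K2 * ‖iteratedFDeriv ℝ 1 V y‖ +
          |deriv (deriv (deriv g)) (y 2)| * ‖V y‖ := by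
      refine hle.trans (add_le_add (add_le_add ?_ ?_) le_rfl)
      · calc |deriv g (y 2)| * (‖iteratedFDeriv ℝ 1 (curl V) y‖ + ‖iteratedFDeriv ℝ 2 V y‖)
            ≤ K1 * (4 * ‖iteratedFDeriv ℝ 2 V y‖ + ‖iteratedFDeriv ℝ 2 V y‖) :=
              mul_le_mul (hK1 _) (add_le_add (hω1 y) le_rfl) (by positivity) hK1nn
          _ = 5 * K1 * ‖iteratedFDeriv ℝ 2 V y‖ := by ring
      · calc |deriv (deriv g) (y 2)| * (‖curl V y‖ + 2 * ‖iteratedFDeriv ℝ 1 V y‖)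
            ≤ K2 * (4 * ‖iteratedFDeriv ℝ 1 V y‖ + 2 * ‖iteratedFDeriv ℝ 1 V y‖) :=
              mul_le_mul (hK2 _) (add_le_add (hω0 y) le_rfl) (by positivity) hK2nn
          _ = 6 * K2 * ‖iteratedFDeriv ℝ 1 V y‖ := by ring
    have hsq := sq_le_three_sq (norm_nonneg _) hb
    simp only [Pi.add_apply]
    calc _ ≤ 3 * (5 * K1 * ‖iteratedFDeriv ℝ 2 V y‖) ^ 2 + 3 * (6 * K2 * ‖iteratedFDeriv ℝ 1 V y‖) ^ 2 +
          3 * (|deriv (deriv (deriv g)) (y 2)| * ‖V y‖) ^ 2 := hsq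
      _ = 3 * (5 * K1) ^ 2 * ‖iteratedFDeriv ℝ 2 V y‖ ^ 2 + 3 * (6 * K2) ^ 2 * ‖iteratedFDeriv ℝ 1 V y‖ ^ 2 +
          3 * (deriv (deriv (deriv g)) (y 2) ^ 2 * ‖V y‖ ^ 2) := by
          simp only [mul_pow, sq_abs]; ring
      _ ≤ 3 * (5 * K1) ^ 2 * ‖iteratedFDeriv ℝ 2 V y‖ ^ 2 + 3 * (6 * K2) ^ 2 * ‖iteratedFDeriv ℝ 1 V y‖ ^ 2 +
          3 * (K3 ^ 2 * S.indicator (fun x => ‖V x‖ ^ 2) y) :=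
          add_le_add le_rfl (mul_le_mul_of_nonneg_left (hind3 y) zero_le_three)

/-- **`R ∈ L²` and `∂₂R ∈ L²`** as `MemLp` statements (`‖∂₂R(x)‖ ≤ ‖D¹R(x)‖`). [folklore] -/
theorem memLp_curlRemainder (hV : ContDiff ℝ ∞ V) (hg : ContDiff ℝ ∞ g) {T K1 K2 K3 : ℝ}
    (hK1 : ∀ s, |deriv g s| ≤ K1) (hK2 : ∀ s, |deriv (deriv g) s| ≤ K2) (hK3 : ∀ s, |deriv (deriv (deriv g)) s| ≤ K3)
    (hT2 : ∀ s, T < |s| → deriv (deriv g) s = 0) (hT3 : ∀ s, T < |s| → deriv (deriv (deriv g)) s = 0)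
    (h1 : ∫⁻ x, ‖iteratedFDeriv ℝ 1 V x‖ₑ ^ 2 < ⊤) (h2 : ∫⁻ x, ‖iteratedFDeriv ℝ 2 V x‖ₑ ^ 2 < ⊤)
    (hslab : Integrable (fun x => {x : EuclideanSpace ℝ (Fin 3) | |x 2| ≤ T}.indicator (fun x => ‖V x‖ ^ 2) x) volume) :
    MemLp (fun y : EuclideanSpace ℝ (Fin 3) =>
        fderiv ℝ (curl (fun z : EuclideanSpace ℝ (Fin 3) => g (z 2) • V z)) y - g (y 2) • fderiv ℝ (curl V) y) 2
        (volume : Measure (EuclideanSpace ℝ (Fin 3))) ∧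
      MemLp (fun x : EuclideanSpace ℝ (Fin 3) => fderiv ℝ (fun y : EuclideanSpace ℝ (Fin 3) =>
        fderiv ℝ (curl (fun z : EuclideanSpace ℝ (Fin 3) => g (z 2) • V z)) y - g (y 2) • fderiv ℝ (curl V) y) x
          (EuclideanSpace.single (2 : Fin 3) (1 : ℝ))) 2 (volume : Measure (EuclideanSpace ℝ (Fin 3))) := by
  have hR := contDiff_curlRemainder hV hg
  obtain ⟨i0, i1⟩ := integrable_sq_norm_curlRemainder hV hg hK1 hK2 hK3 hT2 hT3 h1 h2 hslab
  refine ⟨(memLp_two_iff_integrable_sq_norm hR.continuous.aestronglyMeasurable).2 i0, ?_⟩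
  refine memLp_two_of_norm_le_mul (K := 1) ((hR.continuous_fderiv (by simp)).clm_apply continuous_const)
    (hR.continuous_iteratedFDeriv (WithTop.coe_le_coe.mpr le_top)) i1 fun x => ?_
  have e1 : ‖iteratedFDeriv ℝ 0 (fderiv ℝ (fun y : EuclideanSpace ℝ (Fin 3) =>
      fderiv ℝ (curl (fun z : EuclideanSpace ℝ (Fin 3) => g (z 2) • V z)) y - g (y 2) • fderiv ℝ (curl V) y)) x‖ =
      ‖iteratedFDeriv ℝ 1 (fun y : EuclideanSpace ℝ (Fin 3) =>
      fderiv ℝ (curl (fun z : EuclideanSpace ℝ (Fin 3) => g (z 2) • V z)) y - g (y 2) • fderiv ℝ (curl V) y) x‖ :=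
    norm_iteratedFDeriv_fderiv
  rw [one_mul, ← e1, norm_iteratedFDeriv_zero]
  refine (ContinuousLinearMap.le_opNorm _ _).trans (le_of_eq ?_)
  rw [PiLp.norm_single, norm_one, mul_one]

/-! ## 5. The sliding-average coefficients `DKⱼ`, `Kⱼ = ∂ⱼ(g′V₂)` -/

/-- **`D(∂_w(g′V₂)) ∈ L²`**: continuous, bounded by `‖w‖‖D²(g′V₂)‖`, hence in `L²` on a square-integrable layer. [folklore] -/
theorem memLp_fderiv_slideCoeffDeriv (hV : ContDiff ℝ ∞ V) (hg : ContDiff ℝ ∞ g) {T K1 K2 K3 : ℝ}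
    (hK1 : ∀ s, |deriv g s| ≤ K1) (hK2 : ∀ s, |deriv (deriv g) s| ≤ K2) (hK3 : ∀ s, |deriv (deriv (deriv g)) s| ≤ K3)
    (hT2 : ∀ s, T < |s| → deriv (deriv g) s = 0) (hT3 : ∀ s, T < |s| → deriv (deriv (deriv g)) s = 0)
    (h1 : ∫⁻ x, ‖iteratedFDeriv ℝ 1 V x‖ₑ ^ 2 < ⊤) (h2 : ∫⁻ x, ‖iteratedFDeriv ℝ 2 V x‖ₑ ^ 2 < ⊤)
    (hslab : Integrable (fun x => {x : EuclideanSpace ℝ (Fin 3) | |x 2| ≤ T}.indicator (fun x => ‖V x‖ ^ 2) x) volume)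
    (w : EuclideanSpace ℝ (Fin 3)) :
    Continuous (fderiv ℝ (fun y : EuclideanSpace ℝ (Fin 3) =>
        fderiv ℝ (fun z : EuclideanSpace ℝ (Fin 3) => deriv g (z 2) * V z 2) y w)) ∧
      MemLp (fderiv ℝ (fun y : EuclideanSpace ℝ (Fin 3) =>
        fderiv ℝ (fun z : EuclideanSpace ℝ (Fin 3) => deriv g (z 2) * V z 2) y w)) 2
        (volume : Measure (EuclideanSpace ℝ (Fin 3))) := by
  set G : EuclideanSpace ℝ (Fin 3) → ℝ := fun z => deriv g (z 2) * V z 2 with hG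
  have hproj : ContDiff ℝ ∞ fun y : EuclideanSpace ℝ (Fin 3) => y 2 :=
    (EuclideanSpace.proj (2 : Fin 3) : EuclideanSpace ℝ (Fin 3) →L[ℝ] ℝ).contDiff
  have hγ : ContDiff ℝ ∞ (deriv g) := (contDiff_infty_iff_deriv.mp hg).2
  have hGs : ContDiff ℝ ∞ G := (hγ.comp hproj).mul (hproj.comp hV)
  have hDGs : ContDiff ℝ ∞ (fderiv ℝ G) := hGs.fderiv_right (m := ∞) (by exact_mod_cast le_rfl)
  have hKs : ContDiff ℝ ∞ fun y : EuclideanSpace ℝ (Fin 3) => fderiv ℝ G y w := hDGs.clm_apply contDiff_const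
  obtain ⟨-, hG2⟩ := lintegral_iteratedFDeriv_axialWeight_mul_coord_lt_top hV hg hK1 hK2 hK3 hT2 hT3 h1 h2 hslab
  have iG2 : Integrable (fun x => ‖iteratedFDeriv ℝ 2 G x‖ ^ 2) (volume : Measure (EuclideanSpace ℝ (Fin 3))) :=
    integrable_sq_norm_of_lintegral (hGs.continuous_iteratedFDeriv (WithTop.coe_le_coe.mpr le_top)) hG2
  refine ⟨hKs.continuous_fderiv (by simp), ?_⟩
  refine memLp_two_of_norm_le_mul (K := ‖w‖) (hKs.continuous_fderiv (by simp))
    (hGs.continuous_iteratedFDeriv (WithTop.coe_le_coe.mpr le_top)) iG2 fun x => ?_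
  have e1 : ‖iteratedFDeriv ℝ 0 (fderiv ℝ (fun y : EuclideanSpace ℝ (Fin 3) => fderiv ℝ G y w)) x‖ =
      ‖iteratedFDeriv ℝ 1 (fun y : EuclideanSpace ℝ (Fin 3) => fderiv ℝ G y w) x‖ := norm_iteratedFDeriv_fderiv
  have e2 : ‖iteratedFDeriv ℝ 1 (fderiv ℝ G) x‖ = ‖iteratedFDeriv ℝ 2 G x‖ := norm_iteratedFDeriv_fderiv
  rw [norm_iteratedFDeriv_zero] at e1
  rw [e1, ← e2]
  exact norm_iteratedFDeriv_clm_apply_const (hDGs.of_le (by exact_mod_cast le_top)).contDiffAt le_rfl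

end ExtremiserLiouville

end Summit.NavierStokesRegularity.NavierStokesRegularity.Theorems

end
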